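import Literature.NumberTheory.EllipticCurves.LegendreFormValuation
import Literature.NumberTheory.DiophantineGeometry.LocalReductionHasMultiplicativeReductionAtProofs
import Literature.NumberTheory.DiophantineGeometry.LocalReductionIsIntegralAtProofs
import HarnessLib

/-!
# The Legendre equation at an EVEN-order pole of `λ`: multiplicative reduction (`v ∤ 2`)

Topic `NumberTheory/EllipticCurves` (`Proofs` file: theorems only). Silverman, *The Arithmetic of Elliptic Curves*
(2nd ed.), proof of Prop. VII.5.4 (c) / Prop. VII.5.5 (PDF pp. 176–177: the Legendre equation `y² = x(x−1)(x−λ)` at an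
odd place; when `|λ| > 1` one rescales), and VII.5 Prop. 5.1 (b) (multiplicative reduction iff `v(c₄) = 0`, `v(Δ) > 0`
on an integral equation; the tree's `hasMultiplicativeReductionAt_of_valuation_c₄_eq_one`).

For a Dedekind domain `A` with fraction field `K`, a finite place `v` with `|2|_v = 1`, and `λ ∈ K` with an EVEN-order
pole at `v` (`|λ|_v = exp(2m)`, `m ≥ 1`, in Mathlib's multiplicative normalisation): the Legendre equation
`y² = x(x−1)(x−λ) = ⟨0, −(1+λ), 0, λ, 0⟩` has MULTIPLICATIVE reduction at `v`. Indeed with a uniformiser `π` and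
`α = π^m`, `B = λ·α²` (a `v`-unit), the `K`-isomorphic equation `y² = x(x − α²)(x − B) = ⟨0, −(α²+B), 0, α²B, 0⟩`
(rescaling by `u = α`, the tree's `smul_sq_eq_legendre`) is `v`-integral with `c₄ = 16(α⁴ − α²B + B²)` a `v`-unit and
`Δ = 16α⁴B²(α²−B)²` of valuation `|α|⁴ < 1` — it reduces to the nodal cubic `y² = x²(x − B̄)`.

* `Literature.NumberTheory.EllipticCurves.c₄_twoRootForm`, `…Δ_twoRootForm` — `c₄`, `Δ` of `⟨0, −(a+b), 0, ab, 0⟩`;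
* **`…hasMultiplicativeReductionAt_legendre_of_valuation_eq_exp_two_mul`** — the statement above.

(At an ODD-order pole the reduction is additive, potentially multiplicative — the quadratic twist by `√λ` is needed;
at `|λ| < 1` or `|λ − 1| < 1` the Legendre equation is itself nodal. Only the even-pole case is proved here: it is the
input of the abc-iut cell's «k even ⇒ e(v|7) ∣ 15» refinement of the local type of `F_tpd(√−1, √λ, √(λ−1), E_λ[15])`.)

## References

* [SilvermanAEC2009] J. H. Silverman, *The Arithmetic of Elliptic Curves*, 2nd ed. (2009), VII.5 Prop. 5.1 (b),
  proof of Prop. VII.5.4 (c) and of Prop. VII.5.5; III.1 Prop. 1.7.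
-/

noncomputable section

namespace Literature.NumberTheory.EllipticCurves

open _root_.WeierstrassCurve IsDedekindDomain

variable {A : Type*} [CommRing A] [IsDedekindDomain A] {K : Type*} [Field K] [Algebra A K]
  [IsFractionRing A K] (v : HeightOneSpectrum A)

/-- `c₄ = 16(a² − ab + b²)` for `y² = x(x − a)(x − b) = ⟨0, −(a+b), 0, ab, 0⟩`. [cite: SilvermanAEC2009, III.1 (c₄ = b₂² − 24b₄)] -/
theorem c₄_twoRootForm (a b : K) :
    (⟨0, -(a + b), 0, a * b, 0⟩ : WeierstrassCurve K).c₄ = 16 * (a ^ 2 - a * b + b ^ 2) := by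
  simp only [WeierstrassCurve.c₄, WeierstrassCurve.b₂, WeierstrassCurve.b₄]; ring

/-- `Δ = 16a²b²(a − b)²` for `y² = x(x − a)(x − b) = ⟨0, −(a+b), 0, ab, 0⟩` (the discriminant of a cubic with roots
`0, a, b`). [cite: SilvermanAEC2009, III.1 Prop. 1.7 (proof)] -/
theorem Δ_twoRootForm (a b : K) :
    (⟨0, -(a + b), 0, a * b, 0⟩ : WeierstrassCurve K).Δ = 16 * a ^ 2 * b ^ 2 * (a - b) ^ 2 := by
  simp only [WeierstrassCurve.Δ, WeierstrassCurve.b₂, WeierstrassCurve.b₄, WeierstrassCurve.b₆,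
    WeierstrassCurve.b₈]; ring

/-- **The Legendre equation `y² = x(x−1)(x−λ)` has MULTIPLICATIVE reduction at a place `v ∤ 2` where `λ` has a pole of
EVEN order** (`|λ|_v = exp(2m)`, `m ≥ 1`): rescaling by `α = π^m` gives the `v`-integral nodal equation
`y² = x(x − α²)(x − λα²)` with unit `c₄` and `|Δ|_v = |α|_v⁴ < 1` (Silverman VII.5.1 (b)).
[cite: SilvermanAEC2009, VII.5 Prop. 5.1 (b) and proof of Prop. VII.5.4 (c) (PDF pp. 174–177)] -/
theorem hasMultiplicativeReductionAt_legendre_of_valuation_eq_exp_two_mul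
    (h2 : v.valuation K (2 : K) = 1) {la : K} {m : ℕ} (hm : 0 < m)
    (hla : v.valuation K la = WithZero.exp (2 * (m : ℤ))) :
    (⟨0, -(1 + la), 0, la, 0⟩ : WeierstrassCurve K).HasMultiplicativeReductionAt v := by
  -- `2 ≠ 0` in `K`
  have h20 : (2 : K) ≠ 0 := by
    intro h; rw [h, map_zero] at h2; exact zero_ne_one h2
  have h16ne : (16 : K) ≠ 0 := by
    rw [show (16 : K) = 2 ^ 4 by norm_num]; exact pow_ne_zero _ h20
  -- a uniformiser and the rescaling parameter `α = π^m`
  obtain ⟨π, hπ⟩ := v.valuation_exists_uniformizer K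
  have hπ0 : π ≠ 0 := by
    intro h; rw [h, map_zero] at hπ; exact WithZero.exp_ne_zero hπ.symm
  set α : K := π ^ m with hαdef
  have hα0 : α ≠ 0 := pow_ne_zero _ hπ0
  have hα : v.valuation K α = WithZero.exp (-(m : ℤ)) := by
    rw [hαdef, map_pow, hπ, ← WithZero.exp_nsmul]
    congr 1
    rw [nsmul_eq_mul]; ring
  have hα2 : v.valuation K (α ^ 2) = WithZero.exp (-(2 * (m : ℤ))) := by
    rw [map_pow, hα, ← WithZero.exp_nsmul]
    congr 1
    rw [nsmul_eq_mul]; push_cast; ring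
  have hα2lt : v.valuation K (α ^ 2) < 1 := by
    rw [hα2, ← WithZero.exp_zero, WithZero.exp_lt_exp]
    omega
  set B : K := la * α ^ 2 with hBdef
  have hB : v.valuation K B = 1 := by
    rw [hBdef, map_mul, hla, hα2, ← WithZero.exp_add, ← WithZero.exp_zero]
    congr 1
    ring
  have hla0 : la ≠ 0 := by
    intro h
    rw [h, map_zero] at hla
    exact WithZero.exp_ne_zero hla.symm
  -- the integral nodal model and the rescaling to the Legendre equation
  set W : WeierstrassCurve K := ⟨0, -(α ^ 2 + B), 0, α ^ 2 * B, 0⟩ with hWdef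
  set C : VariableChange K := ⟨Units.mk0 α hα0, 0, 0, 0⟩ with hCdef
  have hBla : B / α ^ 2 = la := by
    rw [hBdef]; field_simp
  have hWL : C • W = (⟨0, -(1 + la), 0, la, 0⟩ : WeierstrassCurve K) := by
    rw [hCdef, hWdef, smul_sq_eq_legendre hα0, hBla]
  -- the Legendre equation is elliptic (`λ ≠ 0, 1` since `|λ| > 1`), hence so is `W`
  have hla1 : la ≠ 1 := by
    intro h
    rw [h, map_one, ← WithZero.exp_zero] at hla
    have := WithZero.exp_injective hla
    omega
  haveI hE : (⟨0, -(1 + la), 0, la, 0⟩ : WeierstrassCurve K).IsElliptic := by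
    refine ⟨isUnit_iff_ne_zero.mpr ?_⟩
    rw [legendre_Δ]
    exact mul_ne_zero (mul_ne_zero h16ne (pow_ne_zero _ hla0)) (pow_ne_zero _ (sub_ne_zero.mpr hla1))
  haveI : W.IsElliptic := by
    have hW : W = C⁻¹ • (⟨0, -(1 + la), 0, la, 0⟩ : WeierstrassCurve K) := by rw [← hWL, inv_smul_smul]
    rw [hW]; infer_instance
  -- valuations of the coefficients, `c₄` and `Δ` of `W`
  have h16 : v.valuation K (16 : K) = 1 := by
    rw [show (16 : K) = 2 ^ 4 by norm_num, map_pow, h2, one_pow]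
  have ha2 : v.valuation K (α ^ 2 + B) = 1 := by
    rw [add_comm, Valuation.map_add_eq_of_lt_left _ (by rw [hB]; exact hα2lt), hB]
  have ha4 : v.valuation K (α ^ 2 * B) < 1 := by
    rw [map_mul, hB, mul_one]; exact hα2lt
  have hsub : v.valuation K (α ^ 2 - B) = 1 := by
    rw [show α ^ 2 - B = -(B - α ^ 2) by ring, Valuation.map_neg,
      Valuation.map_sub_eq_of_lt_left _ (by rw [hB]; exact hα2lt), hB]
  have hc₄ : v.valuation K W.c₄ = 1 := by
    rw [hWdef, c₄_twoRootForm, map_mul, h16, one_mul,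
      show (α ^ 2) ^ 2 - α ^ 2 * B + B ^ 2 = B ^ 2 + α ^ 2 * (α ^ 2 - B) by ring]
    have hlt : v.valuation K (α ^ 2 * (α ^ 2 - B)) < v.valuation K (B ^ 2) := by
      rw [map_mul, hsub, mul_one, sq B, map_mul, hB, mul_one]; exact hα2lt
    rw [Valuation.map_add_eq_of_lt_left _ hlt, sq B, map_mul, hB, mul_one]
  have hΔ : v.valuation K W.Δ < 1 := by
    rw [hWdef, Δ_twoRootForm]
    simp only [map_mul, map_pow, h16, hsub, hB, hα, one_pow, mul_one, one_mul]
    rw [← WithZero.exp_nsmul, ← WithZero.exp_nsmul, ← WithZero.exp_zero, WithZero.exp_lt_exp, nsmul_eq_mul,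
      nsmul_eq_mul]
    push_cast
    omega
  have hint : W.IsIntegralAt v := by
    rw [isIntegralAt_iff_valuation_le_one]
    refine ⟨by simp [hWdef], ?_, by simp [hWdef], ?_, by simp [hWdef]⟩
    · change v.valuation K (-(α ^ 2 + B)) ≤ 1
      rw [Valuation.map_neg, ha2]
    · change v.valuation K (α ^ 2 * B) ≤ 1
      exact ha4.le
  have hmultW : W.HasMultiplicativeReductionAt v := hasMultiplicativeReductionAt_of_valuation_c₄_eq_one hint hc₄ hΔ
  rw [← hWL]
  exact (hasMultiplicativeReductionAt_smul_iff_holds v W C).mpr hmultW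

end Literature.NumberTheory.EllipticCurves

end
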